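import Literature.Computability.QuantumComplexity.RevGadgets
import Mathlib.Data.List.FinRange
import Mathlib.Data.Fintype.Basic
import Mathlib.Data.Fintype.Pi
import Mathlib.Data.Fintype.Prod
import Mathlib.Data.Fintype.Sum
import Mathlib.Algebra.BigOperators.Fin
import Mathlib.Algebra.Group.Action.Defs
import Mathlib.Data.Fintype.EquivFin
import Mathlib.Logic.Equiv.Fin.Basic
import HarnessLib

/-!
# The reversible tableau of a window machine

Second toolkit file towards the reversible core `uniformReversibleSimulation` of `BPP ⊆ BQP`
(Bernstein–Vazirani 1997, Thm. 8.3; Arora–Barak 2009, Thm. 6.6 with Lemma 10.10 and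
Cor. 10.11): the *tableau* of a time-`T` computation as a reversible `NOT`/`CNOT`/Toffoli
program (`RevGadgets`), for an abstract **window machine**.

A window machine `WM` (the finite datum extracted from a multi-stack Turing machine by the
window lemma of `TM2Window`: one step reads and rewrites only the top `d` symbols of every
stack) has label codes `Fin nL`, state codes `Fin nV`, `κ` stacks of cells holding symbol
codes `Fin A`, a window depth `d` and a finite control table `ctrl`: from the label, the state
and the top-`d` windows it produces the new label, the new state and, for every stack, the
list of at most `2d` new top cells replacing the window (cells below the window shift by
`d - (length of the new top)`); `WM.step` is the induced map on configurations
(`WM.Cfg`: label, state, and cells `Fin κ → ℕ → Fin A`, cell `0` = top).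

The tableau (Sipser 2012, proof of Thm. 9.30, "lights"; Arora–Barak 2009, proof of Thm. 6.6)
has, for input-independent sizes `S` (cells per stack) and `T` (steps), the wires
`TIdx = (Fin (T+1) × BIdx) ⊕ (Fin T × Pat × Fin (r+1))`: block `t` holds configuration `t`
in **one-hot** form (`BIdx = Fin nL ⊕ Fin nV ⊕ (Fin κ × Fin S × Fin A)`, wire `(k, j, g)` on
iff cell `j` of stack `k` holds code `g`), and for every step `t` and every *pattern*
`ξ ∈ Pat = Fin nL × Fin nV × (Fin κ → Fin d → Fin A)` (a possible content of label, state and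
windows) there are `r + 1` ancillas, `r = 2 + κ d`. Patterns are numbered explicitly
(`WM.ePat`, mixed radix via `finProdFinEquiv`/`finFunctionFinEquiv`; `WM.patList` lists them in
this order). The program of step `t` (`stepOps`) runs over all patterns `ξ` in the order of
`patList`: a Toffoli chain (`chainOps`) computes into the last ancilla the
*minterm* `[block t matches ξ]`, and the operations `outOps` controlled by that minterm write
block `t + 1`: `CNOT`s set the new label, state and new top cells prescribed by `ctrl ξ`, and
Toffolis copy the shifted cells `j ← j - |new top| + d` from block `t`. Exactly one minterm
fires, all targets are fresh, so block `t + 1` is the one-hot code of `step` of block `t` —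
on the *exact region* `j + d (t+1) < S` (cells below it may depend on cells beyond the
represented `S`; the light cone of cell `0` at time `T` is `j ≤ d T`).

Main result: `WM.exact_tableau` — if block `0` of the initial assignment is the one-hot code
of `c₀` and all other tableau wires are `0`, then after `tableauOps` block `T` is the one-hot
code of `step^[T] c₀` on the cells `j` with `j + d T < S` (and label and state exactly);
`WM.tableauOps_wf` (all operations have distinct wires). Finally the explicit (affine) wire
numbering `WM.eB : BIdx S ≃ Fin (bsize S)`, `WM.eT : TIdx S T ≃ Fin (tsize S T)` (ancillas by
step, pattern number `ePat` and position) used by the uniform circuit families built on the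
tableau; everything here is computable, in particular the gate order of `tableauOps` and the
numbering `eT` are the ones a generator program can print (`SimUniformity.lean`).

Relation to `Literature/Computability/Complexity/TM2Circuits.lean` (`P ⊆ P/poly`): that file
simulates a `FinTM2` by `B₂` straight-line programs whose layers are obtained from
cell-locality by Shannon expansion (`IsLocal.cktSize`), with existential size constants and
no explicit gate list. Uniform *quantum* families need more: an explicit reversible
(`NOT`/`CNOT`/Toffoli) gate list, each step using fresh ancillas (left dirty, which is
harmless when only one wire is measured at the end), with an affine wire numbering that a
polynomial-time generator can print. This file provides exactly that, for the
abstract window machine; the bridge from `FinTM2` is `TableauBridge.lean`.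

## References

* M. Sipser, *Introduction to the Theory of Computation*, 3rd ed. 2012, Thm. 9.30 (proof:
  tableau of a time-`t` machine with one light per cell and symbol, wired locally).
* S. Arora, B. Barak, *Computational Complexity: A Modern Approach*, CUP 2009, Thm. 6.6
  (proof: snapshots `zᵢ` computed from `zᵢ₋₁` and `z_{prev(i)}`), §10.3.7, Lemma 10.10,
  Cor. 10.11 (`BPP ⊆ BQP`).
* E. Bernstein, U. Vazirani, *Quantum complexity theory*, SIAM J. Comput. 26 (1997),
  Thm. 8.3 (proof: "a synchronized, normal form [reversible] version of `M`").
-/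

namespace Literature.Computability.QuantumComplexity

open Function

/-! ### Window machines -/

/-- A **window machine**: finite control data of a multi-stack machine one step of which
reads and rewrites only the top `d` cells of each of its `κ` stacks. `ctrl l v w` returns the
new label code, the new state code and, for each stack, the new top cells (at most `2 d` of
them) that replace the window `w k : Fin d → Fin A`; symbol code conventions (e.g. `0` =
empty cell) are up to the user. [Sipser 2012, proof of Thm. 9.30; Arora–Barak 2009, proof of
Thm. 6.6 (the transition depends on the state and the symbols under the heads)]
[cite: Sipser2012, Thm. 9.30 (proof)] -/
structure WM where
  /-- number of label codes -/
  nL : ℕ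
  /-- number of state codes -/
  nV : ℕ
  /-- number of stacks -/
  κ : ℕ
  /-- number of symbol codes per cell -/
  A : ℕ
  /-- window depth -/
  d : ℕ
  /-- the control table -/
  ctrl : Fin nL → Fin nV → (Fin κ → Fin d → Fin A) → Fin nL × Fin nV × (Fin κ → List (Fin A))
  /-- the new top segment of every stack has length at most `2 d` -/
  length_ctrl_le : ∀ l v w k, ((ctrl l v w).2.2 k).length ≤ 2 * d

namespace WM

variable (M : WM)

/-- A configuration of a window machine: label code, state code, and the cells of every
stack (cell `0` is the top; all of `ℕ` is used, cells below the bottom hold the user's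
"empty" code). [folklore] -/
@[ext] structure Cfg where
  /-- label code -/
  l : Fin M.nL
  /-- state code -/
  v : Fin M.nV
  /-- `cell k j`: the code in cell `j` of stack `k` -/
  cell : Fin M.κ → ℕ → Fin M.A

/-- Patterns: possible joint contents of the label, the state and the `κ` windows.
[folklore] -/
abbrev Pat : Type := Fin M.nL × Fin M.nV × (Fin M.κ → Fin M.d → Fin M.A)

/-- Patterns have decidable equality (a short-cut instance: the generic search through the
function component exceeds the default instance size). -/
instance instDecidableEqPat : DecidableEq M.Pat := inferInstance

/-- Patterns form a finite type. -/
instance instFintypePat : Fintype M.Pat := inferInstance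

/-- The pattern of a configuration (label, state, top-`d` windows). [folklore] -/
def pat (c : M.Cfg) : M.Pat := (c.l, c.v, fun k i => c.cell k i)

/-- The control table applied to a pattern. [folklore] -/
def out (ξ : M.Pat) : Fin M.nL × Fin M.nV × (Fin M.κ → List (Fin M.A)) := M.ctrl ξ.1 ξ.2.1 ξ.2.2

/-- The new top cells of stack `k` prescribed for the pattern `ξ`. [folklore] -/
def newTop (ξ : M.Pat) (k : Fin M.κ) : List (Fin M.A) := (M.out ξ).2.2 k

/-- New top segments have length at most `2 d`. [folklore] -/
theorem length_newTop_le (ξ : M.Pat) (k : Fin M.κ) : (M.newTop ξ k).length ≤ 2 * M.d :=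
  M.length_ctrl_le _ _ _ k

/-- **One step of a window machine**: new label and state from the control table; cell `j`
of stack `k` becomes the `j`-th new top cell if `j < |newTop|`, and otherwise the old cell
`j - |newTop| + d` (the part below the window shifts). (`TM2` form of a Turing machine step,
cf. `TM2Window.getElem?_stepTotal_stk`.) [cite: Sipser2012, Thm. 9.30 (proof)] -/
def step (c : M.Cfg) : M.Cfg where
  l := (M.out (M.pat c)).1
  v := (M.out (M.pat c)).2.1
  cell k j :=
    if h : j < (M.newTop (M.pat c) k).length then (M.newTop (M.pat c) k)[j]
    else c.cell k (j - (M.newTop (M.pat c) k).length + M.d)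

/-! ### Wires of the tableau -/

/-- Wires of one block (one-hot code of a configuration with `S` cells per stack): a wire
per label code, per state code, and per (stack, cell, symbol code). [Sipser 2012, proof of
Thm. 9.30 (`light[i, j, s]`)] [cite: Sipser2012, Thm. 9.30 (proof)] -/
abbrev BIdx (S : ℕ) : Type := Fin M.nL ⊕ Fin M.nV ⊕ (Fin M.κ × Fin S × Fin M.A)

/-- Block indices have decidable equality (short-cut instance). -/
instance instDecidableEqBIdx (S : ℕ) : DecidableEq (M.BIdx S) := inferInstance

/-- The wire of block index "cell `j` of stack `k` holds code `g`". [folklore] -/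
def cellB {S : ℕ} (k : Fin M.κ) (j : Fin S) (g : Fin M.A) : M.BIdx S := Sum.inr (Sum.inr (k, j, g))

/-- The one-hot code of a configuration on a block. [Sipser 2012, proof of Thm. 9.30]
[cite: Sipser2012, Thm. 9.30 (proof)] -/
def enc {S : ℕ} (c : M.Cfg) : M.BIdx S → Bool
  | Sum.inl l => decide (c.l = l)
  | Sum.inr (Sum.inl v) => decide (c.v = v)
  | Sum.inr (Sum.inr (k, j, g)) => decide (c.cell k j = g)

/-- The number of literals of a minterm: label, state, and `κ d` window cells. [folklore] -/
def r : ℕ := 2 + M.κ * M.d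

/-- Wires of the tableau with `S` cells per stack and `T` steps: `T + 1` blocks, and for
each step and pattern `r + 1` ancillas (the seed and the conjunction chain).
[cite: Sipser2012, Thm. 9.30 (proof)] -/
abbrev TIdx (S T : ℕ) : Type := (Fin (T + 1) × M.BIdx S) ⊕ (Fin T × M.Pat × Fin (M.r + 1))

/-- Tableau wires have decidable equality (short-cut instance). -/
instance instDecidableEqTIdx (S T : ℕ) : DecidableEq (M.TIdx S T) := inferInstance

/-- Tableau wires form a finite type (short-cut instance). -/
instance instFintypeTIdx (S T : ℕ) : Fintype (M.TIdx S T) := inferInstance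

/-! ### Numbering and enumeration of the patterns -/

/-- The number of patterns: `nL · (nV · (A ^ d) ^ κ)` (reducible, so that the `Fin` product
equivalences below elaborate at this type). [folklore] -/
abbrev nPat : ℕ := M.nL * (M.nV * (M.A ^ M.d) ^ M.κ)

/-- **Explicit numbering of the patterns**: `(l, v, w) ↦` the mixed-radix number of `l`, `v`
and the window contents `w` (`finProdFinEquiv`, `finFunctionFinEquiv`). [folklore] -/
def ePat : M.Pat ≃ Fin M.nPat :=
  (Equiv.prodCongr (Equiv.refl _) ((Equiv.prodCongr (Equiv.refl _)
    ((Equiv.piCongrRight fun _ => finFunctionFinEquiv).trans finFunctionFinEquiv)).trans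
      finProdFinEquiv)).trans finProdFinEquiv

/-- **The enumeration of all patterns**, in the order of their numbers `ePat`. [folklore] -/
def patList : List M.Pat := (List.finRange M.nPat).map M.ePat.symm

/-- Every pattern is listed. [folklore] -/
theorem mem_patList (ξ : M.Pat) : ξ ∈ M.patList :=
  List.mem_map.2 ⟨M.ePat ξ, List.mem_finRange _, M.ePat.symm_apply_apply ξ⟩

/-- The patterns are listed once each. [folklore] -/
theorem patList_nodup : M.patList.Nodup :=
  (List.nodup_finRange _).map M.ePat.symm.injective

/-- The `i`-th listed pattern is the pattern number `i`. [folklore] -/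
theorem patList_getElem (i : ℕ) (h : i < M.patList.length) :
    M.patList[i] = M.ePat.symm ⟨i, by simpa [patList] using h⟩ := by
  simp [patList]

/-! ### The program of one step -/

section Ops

variable {M} {S T : ℕ} (hS : 3 * M.d ≤ S)

/-- The literals of the minterm of pattern `ξ` read in block `t`: the label wire `ξ.1`, the
state wire `ξ.2.1` and, for every stack `k` and window position `i < d`, the wire
"cell `i` of stack `k` holds `ξ.2.2 k i`". [cite: Sipser2012, Thm. 9.30 (proof)] -/
def lits (t : Fin (T + 1)) (ξ : M.Pat) : List (M.TIdx S T) :=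
  Sum.inl (t, Sum.inl ξ.1) :: Sum.inl (t, Sum.inr (Sum.inl ξ.2.1)) ::
    (List.finRange M.κ).flatMap fun (k : Fin M.κ) => (List.finRange M.d).map fun (i : Fin M.d) =>
      Sum.inl (t, M.cellB k ⟨i, by have := i.2; omega⟩ (ξ.2.2 k i))

/-- The `q`-th ancilla of pattern `ξ` at step `t`. [folklore] -/
def anc (t : Fin T) (ξ : M.Pat) (q : Fin (M.r + 1)) : M.TIdx S T := Sum.inr (t, ξ, q)

/-- The chain ancillas `1, …, r` of pattern `ξ` at step `t`. [folklore] -/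
def ancs (t : Fin T) (ξ : M.Pat) : List (M.TIdx S T) :=
  (List.finRange M.r).map fun (q : Fin M.r) => anc t ξ q.succ

/-- The minterm wire of pattern `ξ` at step `t` (the last ancilla). [folklore] -/
def mw (t : Fin T) (ξ : M.Pat) : M.TIdx S T := anc t ξ (Fin.last M.r)

/-- The minterm computation of pattern `ξ` at step `t`: set the seed ancilla to `1`, then the
Toffoli conjunction chain over the literals. [Nielsen–Chuang 2010, §3.2.5; Sipser 2012,
proof of Thm. 9.30 (AND of the lights of the cells that affect a cell)]
[cite: Sipser2012, Thm. 9.30 (proof)] -/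
def chainOps (t : Fin T) (ξ : M.Pat) : List (ClOp (M.TIdx S T)) :=
  ClOp.not (anc t ξ 0) :: clChain (anc t ξ 0) (lits hS t.castSucc ξ) (ancs t ξ)

/-- The block indices written for pattern `ξ`: the new label, the new state, for every
stack the new top cells `(k, j, newTop[j])`, `j < |newTop|`, and all cells
`(k, j, g)` with `|newTop| ≤ j < S - d` (targets of the shifted copies). [cite: Sipser2012, Thm. 9.30 (proof)] -/
def tgtList (ξ : M.Pat) : List (M.BIdx S) :=
  Sum.inl (M.out ξ).1 :: Sum.inr (Sum.inl (M.out ξ).2.1) ::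
    (List.finRange M.κ).flatMap fun (k : Fin M.κ) =>
      ((List.finRange (M.newTop ξ k).length).map fun (j : Fin (M.newTop ξ k).length) =>
          M.cellB k ⟨j, by have := j.2; have := M.length_newTop_le ξ k; omega⟩
            ((M.newTop ξ k)[j])) ++
      ((List.finRange (S - M.d - (M.newTop ξ k).length)).flatMap
          fun (i : Fin (S - M.d - (M.newTop ξ k).length)) =>
          (List.finRange M.A).map fun (g : Fin M.A) =>
            M.cellB k ⟨(M.newTop ξ k).length + i, by have := i.2; omega⟩ g)

/-- The source cell (in block `t`) of the shifted copy into cell `j`: `j - |newTop| + d`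
(clamped to `S - 1`, which is inactive for the targets `j < S - d` actually used).
[cite: Sipser2012, Thm. 9.30 (proof)] -/
def srcIdx (ξ : M.Pat) (k : Fin M.κ) (j : Fin S) : Fin S :=
  ⟨min ((j : ℕ) - (M.newTop ξ k).length + M.d) (S - 1), by have := j.2; clear hS; omega⟩

/-- The operation writing block index `b` of block `t + 1` for pattern `ξ`, controlled by
the minterm wire: a `CNOT` for the new label, the new state and the new top cells, a Toffoli
copying the source cell of block `t` for the shifted cells. [Arora–Barak 2009, Lemma 10.10;
Sipser 2012, proof of Thm. 9.30] [cite: Sipser2012, Thm. 9.30 (proof)] -/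
def opFor (t : Fin T) (ξ : M.Pat) : M.BIdx S → ClOp (M.TIdx S T)
  | Sum.inl l => ClOp.cnot (mw t ξ) (Sum.inl (t.succ, Sum.inl l))
  | Sum.inr (Sum.inl v) => ClOp.cnot (mw t ξ) (Sum.inl (t.succ, Sum.inr (Sum.inl v)))
  | Sum.inr (Sum.inr (k, j, g)) =>
      if (j : ℕ) < (M.newTop ξ k).length then ClOp.cnot (mw t ξ) (Sum.inl (t.succ, M.cellB k j g))
      else ClOp.toffoli (mw t ξ) (Sum.inl (t.castSucc, M.cellB k (srcIdx ξ k j) g))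
        (Sum.inl (t.succ, M.cellB k j g))

/-- The output operations of pattern `ξ` at step `t`. [cite: Sipser2012, Thm. 9.30 (proof)] -/
def outOps (t : Fin T) (ξ : M.Pat) : List (ClOp (M.TIdx S T)) :=
  (tgtList hS ξ).map (opFor t ξ)

/-- **The program of step `t`**: for every pattern, in the order of `patList`, its minterm
chain followed by its output operations. [Sipser 2012, proof of Thm. 9.30; Arora–Barak 2009,
proof of Thm. 6.6 and Lemma 10.10] [cite: Sipser2012, Thm. 9.30 (proof)] -/
def stepOps (t : Fin T) : List (ClOp (M.TIdx S T)) :=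
  M.patList.flatMap fun ξ => chainOps hS t ξ ++ outOps hS t ξ

/-- The program of step `t` for `t : ℕ` (empty when `t ≥ T`). [folklore] -/
def stepOpsN (t : ℕ) : List (ClOp (M.TIdx S T)) :=
  if h : t < T then stepOps hS ⟨t, h⟩ else []

/-- **The tableau program**: steps `0, …, T - 1`. [cite: Sipser2012, Thm. 9.30 (proof)] -/
def tableauOps : List (ClOp (M.TIdx S T)) :=
  (List.range T).flatMap (stepOpsN (T := T) hS)

/-! ### Bookkeeping: literals, ancillas, targets -/

/-- Every literal is a wire of block `t`. [folklore] -/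
theorem exists_eq_of_mem_lits {t : Fin (T + 1)} {ξ : M.Pat} {x : M.TIdx S T}
    (hx : x ∈ lits hS t ξ) : ∃ b, x = Sum.inl (t, b) := by
  simp only [lits, List.mem_cons, List.mem_flatMap, List.mem_map, List.mem_finRange,
    true_and] at hx
  rcases hx with rfl | rfl | ⟨k, i, rfl⟩
  · exact ⟨_, rfl⟩
  · exact ⟨_, rfl⟩
  · exact ⟨_, rfl⟩

/-- There are `r = 2 + κ d` literals. [folklore] -/
theorem length_lits (t : Fin (T + 1)) (ξ : M.Pat) : (lits hS t ξ).length = M.r := by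
  simp only [lits, List.length_cons, List.length_flatMap, List.length_map, List.length_finRange,
    List.map_const', List.sum_replicate, smul_eq_mul, WM.r]
  omega

/-- There are `r` chain ancillas. [folklore] -/
theorem length_ancs (t : Fin T) (ξ : M.Pat) : (ancs (S := S) t ξ).length = M.r := by
  simp [ancs]

/-- `anc t ξ` is injective. [folklore] -/
theorem anc_injective (t : Fin T) (ξ : M.Pat) : Injective (anc (S := S) t ξ) := by
  intro q q' h
  simpa [anc] using h

/-- The chain ancillas are pairwise distinct. [folklore] -/
theorem ancs_nodup (t : Fin T) (ξ : M.Pat) : (ancs (S := S) t ξ).Nodup :=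
  (List.nodup_finRange _).map fun _ _ h => Fin.succ_injective _ (anc_injective t ξ h)

/-- Members of `ancs`. [folklore] -/
theorem mem_ancs_iff (t : Fin T) (ξ : M.Pat) (x : M.TIdx S T) :
    x ∈ ancs t ξ ↔ ∃ q : Fin M.r, x = anc t ξ q.succ := by
  simp [ancs, eq_comm]

/-- The seed ancilla is not a chain ancilla. [folklore] -/
theorem anc_zero_not_mem_ancs (t : Fin T) (ξ : M.Pat) : anc (S := S) t ξ 0 ∉ ancs t ξ := by
  rw [mem_ancs_iff]
  rintro ⟨q, h⟩
  exact Fin.succ_ne_zero q (anc_injective t ξ h).symm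

/-- Literals are not ancillas. [folklore] -/
theorem not_mem_ancs_of_mem_lits {t : Fin T} {ξ : M.Pat} {x : M.TIdx S T}
    (hx : x ∈ lits hS t.castSucc ξ) : x ∉ ancs t ξ := by
  obtain ⟨b, rfl⟩ := exists_eq_of_mem_lits hS hx
  rw [mem_ancs_iff]
  rintro ⟨q, h⟩
  cases h

/-- The `q`-th chain ancilla. [folklore] -/
theorem getElem_ancs (t : Fin T) (ξ : M.Pat) (i : ℕ) (hi : i < (ancs (S := S) t ξ).length) :
    (ancs (S := S) t ξ)[i] = anc t ξ (⟨i, by simpa [ancs] using hi⟩ : Fin M.r).succ := by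
  simp [ancs, List.getElem_finRange]

/-- The last chain ancilla is the minterm wire. [folklore] -/
theorem getElem_ancs_last (t : Fin T) (ξ : M.Pat) (h : M.r - 1 < (ancs (S := S) t ξ).length) :
    (ancs (S := S) t ξ)[M.r - 1] = mw t ξ := by
  rw [getElem_ancs]
  unfold mw
  congr 1
  ext
  simp only [Fin.val_succ, Fin.val_last]
  have : 1 ≤ M.r := by unfold WM.r; omega
  omega

/-- The target of `opFor t ξ b` is wire `b` of block `t + 1`. [folklore] -/
theorem target_opFor (t : Fin T) (ξ : M.Pat) (b : M.BIdx S) :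
    (opFor t ξ b).target = Sum.inl (t.succ, b) := by
  rcases b with l | v | ⟨k, j, g⟩
  · rfl
  · rfl
  · simp only [opFor]
    split_ifs <;> rfl

/-- The controls of `opFor t ξ b` are the minterm wire and (for shifted cells) a cell wire
of block `t`. [folklore] -/
theorem mem_controls_opFor {t : Fin T} {ξ : M.Pat} {b : M.BIdx S} {x : M.TIdx S T}
    (hx : x ∈ (opFor t ξ b).controls) : x = mw t ξ ∨ ∃ b', x = Sum.inl (t.castSucc, b') := by
  rcases b with l | v | ⟨k, j, g⟩
  · left; simpa [opFor, ClOp.controls] using hx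
  · left; simpa [opFor, ClOp.controls] using hx
  · simp only [opFor] at hx
    split_ifs at hx
    · left; simpa [ClOp.controls] using hx
    · simp only [ClOp.controls, List.mem_cons, List.not_mem_nil, or_false] at hx
      rcases hx with rfl | rfl
      · exact Or.inl rfl
      · exact Or.inr ⟨_, rfl⟩

/-- If the minterm wire is off, every output guard is off. [folklore] -/
theorem guard_opFor_of_mw (t : Fin T) (ξ : M.Pat) (b : M.BIdx S) (w : M.TIdx S T → Bool)
    (h : w (mw t ξ) = false) : (opFor t ξ b).guard w = false := by
  rcases b with l | v | ⟨k, j, g⟩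
  · simpa [opFor, ClOp.guard] using h
  · simpa [opFor, ClOp.guard] using h
  · simp only [opFor]
    split_ifs
    · simpa [ClOp.guard] using h
    · simp [ClOp.guard, h]

/-- The targets of the output operations are the block indices of `tgtList` in block
`t + 1`. [folklore] -/
theorem map_target_outOps (t : Fin T) (ξ : M.Pat) :
    (outOps hS t ξ).map ClOp.target = (tgtList hS ξ).map fun b => Sum.inl (t.succ, b) := by
  simp [outOps, List.map_map, Function.comp_def, target_opFor]

/-- No target of the output operations is a control of them (targets are in block `t + 1`,
controls in block `t` or ancillas). [folklore] -/
theorem outOps_disjoint (t : Fin T) (ξ : M.Pat) :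
    ∀ op ∈ outOps hS t ξ, ∀ op' ∈ outOps hS t ξ, op'.target ∉ op.controls := by
  intro op hop op' hop' hmem
  simp only [outOps, List.mem_map] at hop hop'
  obtain ⟨b, -, rfl⟩ := hop
  obtain ⟨b', -, rfl⟩ := hop'
  rw [target_opFor] at hmem
  rcases mem_controls_opFor hmem with h | ⟨b'', h⟩
  · cases h
  · simp only [Sum.inl.injEq, Prod.mk.injEq] at h
    exact absurd h.1 (ne_of_gt Fin.castSucc_lt_succ)

/-- Membership of a label wire in `tgtList`. [folklore] -/
theorem inl_mem_tgtList_iff (ξ : M.Pat) (l : Fin M.nL) :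
    (Sum.inl l : M.BIdx S) ∈ tgtList hS ξ ↔ l = (M.out ξ).1 := by
  simp [tgtList, cellB]

/-- Membership of a state wire in `tgtList`. [folklore] -/
theorem inr_inl_mem_tgtList_iff (ξ : M.Pat) (v : Fin M.nV) :
    (Sum.inr (Sum.inl v) : M.BIdx S) ∈ tgtList hS ξ ↔ v = (M.out ξ).2.1 := by
  simp [tgtList, cellB]

/-- Membership of a cell wire in `tgtList`: a new top cell with its prescribed code, or any
code of a shifted cell `|newTop| ≤ j < S - d`. [folklore] -/
theorem cellB_mem_tgtList_iff (ξ : M.Pat) (k : Fin M.κ) (j : Fin S) (g : Fin M.A) :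
    M.cellB k j g ∈ tgtList hS ξ ↔
      (∃ h : (j : ℕ) < (M.newTop ξ k).length, (M.newTop ξ k)[(j : ℕ)] = g) ∨
        ((M.newTop ξ k).length ≤ j ∧ (j : ℕ) < S - M.d) := by
  constructor
  · intro h
    simp only [tgtList, cellB, List.mem_cons, reduceCtorEq, Sum.inr.injEq, false_or,
      List.mem_flatMap, List.mem_finRange, List.mem_append, List.mem_map, true_and,
      Prod.mk.injEq] at h
    obtain ⟨k', h⟩ := h
    rcases h with ⟨j', rfl, hj, rfl⟩ | ⟨i, g', rfl, hj, rfl⟩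
    · left
      have hjj : (j : ℕ) = j' := by rw [← hj]
      refine ⟨by rw [hjj]; exact j'.2, ?_⟩
      simp only [hjj, Fin.getElem_fin]
    · right
      have hjj : (j : ℕ) = (M.newTop ξ k').length + i := by rw [← hj]
      have := i.2
      omega
  · rintro (⟨hj, rfl⟩ | ⟨h1, h2⟩)
    · simp only [tgtList, cellB, List.mem_cons, reduceCtorEq, Sum.inr.injEq, false_or,
        List.mem_flatMap, List.mem_finRange, List.mem_append, List.mem_map, true_and, Prod.mk.injEq]
      exact ⟨k, Or.inl ⟨⟨j, hj⟩, rfl, Fin.ext rfl, rfl⟩⟩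
    · simp only [tgtList, cellB, List.mem_cons, reduceCtorEq, Sum.inr.injEq, false_or,
        List.mem_flatMap, List.mem_finRange, List.mem_append, List.mem_map, true_and, Prod.mk.injEq]
      exact ⟨k, Or.inr ⟨⟨(j : ℕ) - (M.newTop ξ k).length, by omega⟩, g, rfl,
        Fin.ext (by simp; omega), rfl⟩⟩

/-- The written block indices are pairwise distinct. [folklore] -/
theorem tgtList_nodup (ξ : M.Pat) : (tgtList hS ξ).Nodup := by
  unfold tgtList
  refine List.nodup_cons.2 ⟨by simp [cellB], List.nodup_cons.2 ⟨by simp [cellB], ?_⟩⟩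
  rw [List.nodup_flatMap]
  constructor
  · intro k _
    rw [List.nodup_append]
    refine ⟨?_, ?_, ?_⟩
    · refine (List.nodup_finRange _).map fun j j' h => ?_
      simp only [cellB, Sum.inr.injEq, Prod.mk.injEq, Fin.mk.injEq, true_and] at h
      exact Fin.ext h.1
    · rw [List.nodup_flatMap]
      constructor
      · intro i _
        refine (List.nodup_finRange _).map fun g g' h => ?_
        simpa [cellB] using h
      · refine (List.nodup_finRange _).pairwise_of_forall_ne fun i _ i' _ hne => ?_
        simp only [Function.onFun, List.disjoint_left, List.mem_map, List.mem_finRange, true_and]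
        rintro _ ⟨g, rfl⟩ ⟨g', h⟩
        simp only [cellB, Sum.inr.injEq, Prod.mk.injEq, Fin.mk.injEq, true_and] at h
        exact hne (Fin.ext (by omega))
    · rintro _ ha _ hb rfl
      simp only [List.mem_map, List.mem_finRange, true_and, List.mem_flatMap] at ha hb
      obtain ⟨j, hj⟩ := ha
      obtain ⟨i, g, hb⟩ := hb
      rw [← hb] at hj
      simp only [cellB, Sum.inr.injEq, Prod.mk.injEq, Fin.mk.injEq, true_and] at hj
      have := j.2
      omega
  · refine (List.nodup_finRange _).pairwise_of_forall_ne fun k _ k' _ hne => ?_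
    simp only [Function.onFun, List.disjoint_left, List.mem_append, List.mem_map,
      List.mem_finRange, true_and, List.mem_flatMap]
    rintro b hb hb'
    have hk : ∀ {k₀ : Fin M.κ} {j : Fin S} {g : Fin M.A} {b : M.BIdx S}, M.cellB k₀ j g = b →
        ∃ j' g', b = M.cellB k₀ j' g' := fun h => ⟨_, _, h.symm⟩
    obtain ⟨j₁, g₁, rfl⟩ : ∃ j g, b = M.cellB k j g := by
      rcases hb with ⟨j, hj⟩ | ⟨i, g, hj⟩
      · exact hk hj
      · exact hk hj
    have : ∃ j g, M.cellB k j₁ g₁ = M.cellB k' j g := by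
      rcases hb' with ⟨j, hj⟩ | ⟨i, g, hj⟩
      · exact ⟨_, _, hj.symm⟩
      · exact ⟨_, _, hj.symm⟩
    obtain ⟨j, g, h⟩ := this
    simp only [cellB, Sum.inr.injEq, Prod.mk.injEq] at h
    exact hne h.1

/-- The targets of the output operations are pairwise distinct. [folklore] -/
theorem map_target_outOps_nodup (t : Fin T) (ξ : M.Pat) :
    ((outOps hS t ξ).map ClOp.target).Nodup := by
  rw [map_target_outOps]
  exact (tgtList_nodup hS ξ).map fun b b' h => by simpa using h

/-! ### Semantics of one pattern unit -/

/-- **The literals of `ξ` are all on in a one-hot block iff the block's configuration has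
pattern `ξ`.** [cite: Sipser2012, Thm. 9.30 (proof)] -/
theorem all_lits_eq (t : Fin (T + 1)) (ξ : M.Pat) (w : M.TIdx S T → Bool) (c : M.Cfg)
    (hl : ∀ l, w (Sum.inl (t, Sum.inl l)) = decide (c.l = l))
    (hv : ∀ v, w (Sum.inl (t, Sum.inr (Sum.inl v))) = decide (c.v = v))
    (hc : ∀ k (i : ℕ) (hi : i < M.d) g,
      w (Sum.inl (t, M.cellB k ⟨i, by omega⟩ g)) = decide (c.cell k i = g)) :
    (lits hS t ξ).all w = decide (ξ = M.pat c) := by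
  obtain ⟨l, v, f⟩ := ξ
  have hc' : ∀ k (i : Fin M.d), w (Sum.inl (t, M.cellB k ⟨i, by have := i.2; omega⟩ (f k i))) =
      decide (c.cell k i = f k i) := fun k i => hc k i i.2 _
  simp only [lits, List.all_cons, List.all_flatMap, List.all_map, hl, hv]
  rw [Bool.eq_iff_iff]
  simp only [Bool.and_eq_true, decide_eq_true_eq, List.all_eq_true, List.mem_finRange,
    true_implies, Function.comp_apply, hc', WM.pat, Prod.mk.injEq]
  constructor
  · rintro ⟨h1, h2, h3⟩
    exact ⟨h1.symm, h2.symm, funext fun k => funext fun i => (h3 k i).symm⟩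
  · rintro ⟨rfl, rfl, rfl⟩
    exact ⟨rfl, rfl, fun k i => rfl⟩

/-- `List.all` over the literals only reads block `t`. [folklore] -/
theorem all_lits_congr (t : Fin (T + 1)) (ξ : M.Pat) {w w' : M.TIdx S T → Bool}
    (h : ∀ b, w (Sum.inl (t, b)) = w' (Sum.inl (t, b))) :
    (lits hS t ξ).all w = (lits hS t ξ).all w' :=
  List.all_congr_of_forall_mem fun x hx => by
    obtain ⟨b, rfl⟩ := exists_eq_of_mem_lits hS hx
    exact h b

/-- **The minterm chain**: on fresh ancillas, the minterm wire ends up holding the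
conjunction of the literals, and no wire other than the ancillas of `(t, ξ)` changes.
[cite: Sipser2012, Thm. 9.30 (proof)] -/
theorem clEval_chainOps (t : Fin T) (ξ : M.Pat) (w : M.TIdx S T → Bool)
    (hanc : ∀ q, w (anc t ξ q) = false) :
    clEval (chainOps hS t ξ) w (mw t ξ) = (lits hS t.castSucc ξ).all w ∧
      ∀ x, (∀ q, x ≠ anc t ξ q) → clEval (chainOps hS t ξ) w x = w x := by
  have hr : 1 ≤ M.r := by unfold WM.r; omega
  set w₁ := (ClOp.not (anc (S := S) t ξ 0)).eval w with hw₁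
  have hw₁0 : w₁ (anc t ξ 0) = true := by
    rw [hw₁, ClOp.eval_not, update_self, hanc]; rfl
  have hw₁of : ∀ x, x ≠ anc t ξ 0 → w₁ x = w x := fun x hx => by
    rw [hw₁, ClOp.eval_not, update_of_ne hx]
  constructor
  · rw [chainOps, clEval_cons, ← hw₁]
    have hlen : (ancs (S := S) t ξ).length ≤ (lits hS t.castSucc ξ).length := by
      rw [length_ancs, length_lits]
    have hidx : M.r - 1 < (ancs (S := S) t ξ).length := by rw [length_ancs]; omega
    have key := clEval_clChain_getElem (anc t ξ 0) (lits hS t.castSucc ξ) (ancs t ξ) w₁ hlen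
      (ancs_nodup t ξ) (fun x hx => not_mem_ancs_of_mem_lits hS hx)
      (fun a ha => by
        obtain ⟨q, rfl⟩ := (mem_ancs_iff t ξ a).1 ha
        rw [hw₁of _ (fun h => Fin.succ_ne_zero q (anc_injective t ξ h)), hanc])
      (M.r - 1) hidx
    rw [getElem_ancs_last] at key
    rw [key, hw₁0, Bool.true_and, Nat.sub_add_cancel hr, ← length_lits hS t.castSucc ξ,
      List.take_length]
    exact all_lits_congr hS _ _ fun b => hw₁of _ (by simp [anc])
  · intro x hx
    rw [chainOps, clEval_cons, ← hw₁, clEval_clChain_of_not_mem]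
    · exact hw₁of x (hx 0)
    · rw [mem_ancs_iff]
      rintro ⟨q, rfl⟩
      exact hx _ rfl

/-- **A pattern unit whose minterm is off changes nothing but its own ancillas.**
[cite: Sipser2012, Thm. 9.30 (proof)] -/
theorem clEval_unit_of_all_false (t : Fin T) (ξ : M.Pat) (w : M.TIdx S T → Bool)
    (hanc : ∀ q, w (anc t ξ q) = false) (hlit : (lits hS t.castSucc ξ).all w = false)
    (x : M.TIdx S T) (hx : ∀ q, x ≠ anc t ξ q) :
    clEval (chainOps hS t ξ ++ outOps hS t ξ) w x = w x := by
  obtain ⟨h1, h2⟩ := clEval_chainOps hS t ξ w hanc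
  rw [clEval_append, clEval_eq_self_of_guard _ (outOps_disjoint hS t ξ)]
  · exact h2 x hx
  · intro op hop
    obtain ⟨b, -, rfl⟩ := List.mem_map.1 hop
    exact guard_opFor_of_mw t ξ b _ (by rw [h1, hlit])

/-- **A list of pattern units whose minterms are all off changes nothing but their
ancillas.** [cite: Sipser2012, Thm. 9.30 (proof)] -/
theorem clEval_units_of_all_false (t : Fin T) (L : List M.Pat) (hL : L.Nodup)
    (w : M.TIdx S T → Bool) (hanc : ∀ ξ ∈ L, ∀ q, w (anc t ξ q) = false)
    (hlit : ∀ ξ ∈ L, (lits hS t.castSucc ξ).all w = false)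
    (x : M.TIdx S T) (hx : ∀ ξ ∈ L, ∀ q, x ≠ anc t ξ q) :
    clEval (L.flatMap fun ξ => chainOps hS t ξ ++ outOps hS t ξ) w x = w x := by
  induction L generalizing w with
  | nil => rfl
  | cons ξ L ih =>
    rw [List.nodup_cons] at hL
    rw [List.flatMap_cons, clEval_append]
    have hξ := clEval_unit_of_all_false hS t ξ w (hanc ξ (by simp)) (hlit ξ (by simp))
    rw [ih hL.2]
    · exact hξ x (hx ξ (by simp))
    · intro ξ' hξ' q
      rw [hξ _ (fun q' h => hL.1 ?_)]
      · exact hanc ξ' (by simp [hξ']) q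
      · simp only [anc, Sum.inr.injEq, Prod.mk.injEq] at h
        exact h.2.1 ▸ hξ'
    · intro ξ' hξ'
      rw [← hlit ξ' (by simp [hξ'])]
      exact all_lits_congr hS _ _ fun b => hξ _ (fun q h => by cases h)
    · exact fun ξ' hξ' q => hx ξ' (by simp [hξ']) q

open Classical in
/-- **The firing pattern unit.** If the literals of `ξ` are all on and block `t + 1` is
still blank, then after the unit of `ξ`: the new-label and new-state wires prescribed by
`ctrl` are on and the other label/state wires off; a new top cell wire `(k, j, g)`,
`j < |newTop k|`, is on iff `g` is the prescribed code; a shifted cell wire `(k, j, g)`,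
`|newTop k| ≤ j < S - d`, holds the old value of the source wire `(k, j - |newTop k| + d, g)`
of block `t`; nothing outside block `t + 1` and the ancillas of `(t, ξ)` changes.
[Sipser 2012, proof of Thm. 9.30; Arora–Barak 2009, proof of Thm. 6.6, Lemma 10.10]
[cite: Sipser2012, Thm. 9.30 (proof)] -/
theorem clEval_unit_of_all_true (t : Fin T) (ξ : M.Pat) (w : M.TIdx S T → Bool)
    (hanc : ∀ q, w (anc t ξ q) = false) (hlit : (lits hS t.castSucc ξ).all w = true)
    (hblk : ∀ b, w (Sum.inl (t.succ, b)) = false) :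
    (∀ b : M.BIdx S, clEval (chainOps hS t ξ ++ outOps hS t ξ) w (Sum.inl (t.succ, b)) =
      if b ∈ tgtList hS ξ then (opFor t ξ b).guard (clEval (chainOps hS t ξ) w) else false) ∧
    clEval (chainOps hS t ξ) w (mw t ξ) = true ∧
    (∀ b, clEval (chainOps hS t ξ) w (Sum.inl (t.castSucc, b)) = w (Sum.inl (t.castSucc, b))) ∧
    (∀ x, (¬ ∃ b, x = Sum.inl (t.succ, b)) → (∀ q, x ≠ anc t ξ q) →
      clEval (chainOps hS t ξ ++ outOps hS t ξ) w x = w x) := by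
  obtain ⟨h1, h2⟩ := clEval_chainOps hS t ξ w hanc
  set w₁ := clEval (chainOps hS t ξ) w with hw₁
  have hblk₁ : ∀ b, w₁ (Sum.inl (t.succ, b)) = false := fun b => by
    rw [h2 _ (fun q h => by cases h)]; exact hblk b
  refine ⟨fun b => ?_, by rw [h1, hlit], fun b => h2 _ (fun q h => by cases h), fun x hx hx' => ?_⟩
  · rw [clEval_append, ← hw₁]
    split_ifs with hb
    · have := clEval_apply_target_of_nodup (outOps hS t ξ) (outOps_disjoint hS t ξ)
        (map_target_outOps_nodup hS t ξ) w₁ (op := opFor t ξ b) (List.mem_map_of_mem hb)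
      rw [target_opFor] at this
      rw [this, hblk₁]
      simp
    · rw [clEval_apply_of_forall_target_ne]
      · exact hblk₁ b
      · intro op hop e
        obtain ⟨b', hb', rfl⟩ := List.mem_map.1 hop
        rw [target_opFor] at e
        simp only [Sum.inl.injEq, Prod.mk.injEq, true_and] at e
        exact hb (e ▸ hb')
  · rw [clEval_append, ← hw₁, clEval_apply_of_forall_target_ne]
    · exact h2 x hx'
    · intro op hop e
      obtain ⟨b', -, rfl⟩ := List.mem_map.1 hop
      rw [target_opFor] at e
      exact hx ⟨b', e.symm⟩

end Ops

/-! ### The invariant -/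

section Invariant

variable {M} {S T : ℕ} (hS : 3 * M.d ≤ S) (c₀ : M.Cfg)

/-- The configuration at time `s`. [folklore] -/
def cfgAt (s : ℕ) : M.Cfg := M.step^[s] c₀

/-- Block `s` is *exact*: label and state wires are the one-hot code of configuration `s`,
and so are the cell wires `(k, j, g)` in the exact region `j + d s < S`. [Sipser 2012,
proof of Thm. 9.30 (row `i` of the tableau is the configuration at time `i`)]
[cite: Sipser2012, Thm. 9.30 (proof)] -/
structure Exact (w : M.TIdx S T → Bool) (s : Fin (T + 1)) : Prop where
  /-- label wires -/
  lab : ∀ l, w (Sum.inl (s, Sum.inl l)) = decide ((cfgAt c₀ s).l = l)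
  /-- state wires -/
  var : ∀ v, w (Sum.inl (s, Sum.inr (Sum.inl v))) = decide ((cfgAt c₀ s).v = v)
  /-- cell wires in the exact region -/
  cell : ∀ k (j : Fin S) g, (j : ℕ) + M.d * s < S →
    w (Sum.inl (s, M.cellB k j g)) = decide ((cfgAt c₀ s).cell k j = g)

/-- The invariant after `t` steps: blocks `≤ t` exact, blocks `> t` blank, ancillas of steps
`≥ t` blank. [cite: Sipser2012, Thm. 9.30 (proof)] -/
structure Inv (t : ℕ) (w : M.TIdx S T → Bool) : Prop where
  /-- past blocks are exact -/
  exact : ∀ s : Fin (T + 1), (s : ℕ) ≤ t → Exact c₀ w s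
  /-- future blocks are blank -/
  zero : ∀ s : Fin (T + 1), t < s → ∀ b, w (Sum.inl (s, b)) = false
  /-- future ancillas are blank -/
  zeroAnc : ∀ t' : Fin T, t ≤ t' → ∀ ξ q, w (Sum.inr (t', ξ, q)) = false

/-- The invariant at time `0` for an initial assignment with block `0` the one-hot code of
`c₀` and everything else blank. [folklore] -/
theorem inv_zero (w : M.TIdx S T → Bool) (h0 : ∀ b, w (Sum.inl (0, b)) = M.enc c₀ b)
    (hz : ∀ s : Fin (T + 1), s ≠ 0 → ∀ b, w (Sum.inl (s, b)) = false)
    (hza : ∀ x, w (Sum.inr x) = false) : Inv c₀ 0 w := by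
  refine ⟨fun s hs => ?_, fun s hs b => hz s (fun e => by simp [e] at hs) b,
    fun t' _ ξ q => hza _⟩
  have : s = 0 := Fin.ext (by simpa using hs)
  subst this
  exact ⟨fun l => by rw [h0]; rfl, fun v => by rw [h0]; rfl, fun k j g _ => by rw [h0]; rfl⟩

open Classical in
/-- **The inductive step of the tableau.** [Sipser 2012, proof of Thm. 9.30; Arora–Barak
2009, proof of Thm. 6.6] [cite: Sipser2012, Thm. 9.30 (proof)] -/
theorem inv_step (hT : M.d * T ≤ S) (t : Fin T) (w : M.TIdx S T → Bool) (hw : Inv c₀ t w) :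
    Inv c₀ (t + 1) (clEval (stepOps hS t) w) := by
  -- the firing pattern and the splitting of the pattern list around it
  set ξs := M.pat (cfgAt c₀ t) with hξs
  have hmem : ξs ∈ M.patList := M.mem_patList ξs
  have hnd : M.patList.Nodup := M.patList_nodup
  obtain ⟨L₁, L₂, hsplit⟩ := List.append_of_mem hmem
  rw [hsplit, List.nodup_append, List.nodup_cons] at hnd
  obtain ⟨hnd₁, ⟨hξL₂, hnd₂⟩, hdisj⟩ := hnd
  have hξL₁ : ξs ∉ L₁ := fun h => hdisj _ h _ (by simp) rfl
  -- exactness of block `t` in `w`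
  have hEt : Exact c₀ w t.castSucc := hw.exact _ (by simp)
  have hlits : ∀ (w' : M.TIdx S T → Bool), (∀ b, w' (Sum.inl (t.castSucc, b)) =
      w (Sum.inl (t.castSucc, b))) → ∀ ξ, (lits hS t.castSucc ξ).all w' = decide (ξ = ξs) := by
    intro w' hw' ξ
    rw [all_lits_congr hS _ _ hw']
    refine all_lits_eq hS t.castSucc ξ w (cfgAt c₀ t) hEt.lab hEt.var fun k i hi g => ?_
    refine hEt.cell k ⟨i, by omega⟩ g ?_
    have := t.2
    simp only [Fin.val_castSucc]
    have : M.d * (t + 1) ≤ M.d * T := Nat.mul_le_mul_left _ this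
    rw [Nat.mul_succ] at this
    omega
  -- phase 1: the patterns before `ξs`
  set f := fun ξ => chainOps hS t ξ ++ outOps hS t ξ with hf
  have hstep : stepOps hS t = L₁.flatMap f ++ (f ξs ++ L₂.flatMap f) := by
    rw [stepOps, hsplit, List.flatMap_append, List.flatMap_cons]
  set w₁ := clEval (L₁.flatMap f) w with hw₁
  have H1 : ∀ x, (∀ ξ ∈ L₁, ∀ q, x ≠ anc t ξ q) → w₁ x = w x :=
    clEval_units_of_all_false hS t L₁ hnd₁ w
      (fun ξ _ q => hw.zeroAnc t le_rfl ξ q)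
      (fun ξ hξ => by
        rw [hlits w (fun _ => rfl), decide_eq_false_iff_not]
        rintro rfl
        exact hξL₁ hξ)
  have H1blk : ∀ s b, w₁ (Sum.inl (s, b)) = w (Sum.inl (s, b)) := fun s b =>
    H1 _ fun ξ _ q h => by cases h
  -- phase 2: the firing pattern
  set w₂ := clEval (f ξs) w₁ with hw₂
  have hanc₂ : ∀ q, w₁ (anc t ξs q) = false := fun q => by
    rw [H1 _ (fun ξ hξ q' h => hξL₁ ?_)]
    · exact hw.zeroAnc t le_rfl ξs q
    · simp only [anc, Sum.inr.injEq, Prod.mk.injEq] at h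
      exact h.2.1 ▸ hξ
  obtain ⟨H2tgt, H2mw, H2blk, H2off⟩ := clEval_unit_of_all_true hS t ξs w₁ hanc₂
    (by rw [hlits w₁ (H1blk _)]; simp) (fun b => by rw [H1blk]; exact hw.zero _ (by simp) b)
  -- phase 3: the patterns after `ξs`
  set w₃ := clEval (L₂.flatMap f) w₂ with hw₃
  have H3 : ∀ x, (∀ ξ ∈ L₂, ∀ q, x ≠ anc t ξ q) → w₃ x = w₂ x := by
    refine clEval_units_of_all_false hS t L₂ hnd₂ w₂ (fun ξ hξ q => ?_) (fun ξ hξ => ?_)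
    · rw [hw₂, H2off _ (fun ⟨b, h⟩ => by cases h) (fun q' h => hξL₂ ?_)]
      · rw [H1 _ (fun ξ' hξ' q' h => hdisj _ hξ' _ (List.mem_cons_of_mem _ hξ) ?_)]
        · exact hw.zeroAnc t le_rfl ξ q
        · simp only [anc, Sum.inr.injEq, Prod.mk.injEq] at h
          exact h.2.1.symm
      · simp only [anc, Sum.inr.injEq, Prod.mk.injEq] at h
        exact h.2.1 ▸ hξ
    · rw [hlits w₂ (fun b => by
        rw [hw₂, H2off _ (fun ⟨b', h⟩ =>
          absurd (Prod.mk.inj (Sum.inl.inj h)).1 (ne_of_lt Fin.castSucc_lt_succ))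
          (fun q h => by cases h), H1blk])]
      rw [decide_eq_false_iff_not]
      rintro rfl
      exact hξL₂ hξ
  have hfinal : clEval (stepOps hS t) w = w₃ := by
    rw [hstep, clEval_append, clEval_append]
  rw [hfinal]
  -- wires outside block `t + 1` and the ancillas of step `t` are unchanged
  have Hoff : ∀ x, (¬ ∃ b, x = Sum.inl (t.succ, b)) → (¬ ∃ ξ q, x = anc t ξ q) → w₃ x = w x := by
    intro x hx hx'
    rw [H3 x (fun ξ _ q h => hx' ⟨ξ, q, h⟩), hw₂, H2off x hx (fun q h => hx' ⟨_, q, h⟩),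
      H1 x (fun ξ _ q h => hx' ⟨ξ, q, h⟩)]
  -- block `t + 1`
  have Hnew : ∀ b : M.BIdx S, w₃ (Sum.inl (t.succ, b)) =
      if b ∈ tgtList hS ξs then (opFor t ξs b).guard (clEval (chainOps hS t ξs) w₁) else false := by
    intro b
    rw [H3 _ (fun ξ _ q h => by cases h), hw₂]
    exact H2tgt b
  refine ⟨fun s hs => ?_, fun s hs b => ?_, fun t' ht' ξ q => ?_⟩
  · -- exactness of blocks `≤ t + 1`
    rcases Nat.lt_or_ge (s : ℕ) (t + 1) with hlt | hge
    · -- old blocks: unchanged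
      have hne : s ≠ t.succ := fun e => by rw [e] at hlt; simp at hlt
      have hE := hw.exact s (by omega)
      have hoff : ∀ b, w₃ (Sum.inl (s, b)) = w (Sum.inl (s, b)) := fun b =>
        Hoff _ (fun ⟨b', h⟩ => hne (by cases h; rfl)) (fun ⟨ξ, q, h⟩ => by cases h)
      exact ⟨fun l => by rw [hoff]; exact hE.lab l, fun v => by rw [hoff]; exact hE.var v,
        fun k j g hj => by rw [hoff]; exact hE.cell k j g hj⟩
    · -- the new block `t + 1`
      have hs' : s = t.succ := Fin.ext (by rw [Fin.val_succ]; omega)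
      subst hs'
      have hcfg : cfgAt c₀ (t.succ : ℕ) = M.step (cfgAt c₀ t) := by
        simp [cfgAt, Function.iterate_succ_apply']
      refine ⟨fun l => ?_, fun v => ?_, fun k j g hj => ?_⟩
      · rw [Hnew, inl_mem_tgtList_iff, hcfg]
        by_cases hl : l = (M.out ξs).1
        · subst hl
          simp only [if_true, opFor, ClOp.guard, H2mw]
          simp [WM.step, hξs]
        · rw [if_neg hl]
          symm
          rw [decide_eq_false_iff_not]
          exact fun e => hl (by rw [← e]; simp [WM.step, hξs])
      · rw [Hnew, inr_inl_mem_tgtList_iff, hcfg]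
        by_cases hv : v = (M.out ξs).2.1
        · subst hv
          simp only [if_true, opFor, ClOp.guard, H2mw]
          simp [WM.step, hξs]
        · rw [if_neg hv]
          symm
          rw [decide_eq_false_iff_not]
          exact fun e => hv (by rw [← e]; simp [WM.step, hξs])
      · rw [Hnew, hcfg]
        simp only [Fin.val_succ] at hj
        have hLd : (M.newTop ξs k).length ≤ 2 * M.d := M.length_newTop_le ξs k
        by_cases hjL : (j : ℕ) < (M.newTop ξs k).length
        · -- a new top cell
          have hcell : (M.step (cfgAt c₀ t)).cell k j = (M.newTop ξs k)[(j : ℕ)] := by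
            simp only [WM.step, ← hξs]
            rw [dif_pos hjL]
          rw [hcell]
          by_cases hg : (M.newTop ξs k)[(j : ℕ)] = g
          · rw [if_pos ((cellB_mem_tgtList_iff hS ξs k j g).2 (Or.inl ⟨hjL, hg⟩))]
            simp only [cellB, opFor, hjL, ite_true, ClOp.guard, H2mw, hg, decide_true]
          · rw [if_neg]
            · simp [hg]
            · rw [cellB_mem_tgtList_iff]
              rintro (⟨_, h⟩ | ⟨h, _⟩)
              · exact hg h
              · omega
        · -- a shifted cell
          have hjL' := not_lt.1 hjL
          have hjS : (j : ℕ) < S - M.d := by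
            have : M.d ≤ M.d * (↑t + 1) := Nat.le_mul_of_pos_right _ (Nat.succ_pos _)
            omega
          rw [if_pos ((cellB_mem_tgtList_iff hS ξs k j g).2 (Or.inr ⟨hjL', hjS⟩))]
          simp only [cellB, opFor, hjL, ite_false, ClOp.guard, H2mw, Bool.true_and]
          have hsrc : ((srcIdx ξs k j : Fin S) : ℕ) = (j : ℕ) - (M.newTop ξs k).length + M.d := by
            simp only [srcIdx]
            omega
          change clEval (chainOps hS t ξs) w₁
            (Sum.inl (t.castSucc, M.cellB k (srcIdx ξs k j) g)) = _
          rw [H2blk, H1blk, hEt.cell k _ g (by rw [hsrc, Fin.val_castSucc]; rw [Nat.mul_succ] at hj; omega)]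
          congr 1
          simp only [WM.step, ← hξs, hjL, dite_false, hsrc, Fin.val_castSucc]
  · -- future blocks stay blank
    have hne : s ≠ t.succ := by
      rintro rfl
      rw [Fin.val_succ] at hs
      omega
    rw [Hoff _ (fun ⟨b', h⟩ => hne (by cases h; rfl)) (fun ⟨ξ, q, h⟩ => by cases h)]
    exact hw.zero s (by omega) b
  · -- future ancillas stay blank
    have hne : t' ≠ t := by
      rintro rfl
      omega
    rw [Hoff _ (fun ⟨b', h⟩ => by cases h)
      (fun ⟨ξ', q', h⟩ => hne (Prod.mk.inj (Sum.inr.inj h)).1)]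
    exact hw.zeroAnc t' (by omega) ξ q

/-- The invariant along the tableau program. [cite: Sipser2012, Thm. 9.30 (proof)] -/
theorem inv_tableau_prefix (hT : M.d * T ≤ S) (w : M.TIdx S T → Bool) (hw : Inv c₀ 0 w)
    (u : ℕ) (hu : u ≤ T) :
    Inv c₀ u (clEval ((List.range u).flatMap (stepOpsN (T := T) hS)) w) := by
  induction u with
  | zero => simpa using hw
  | succ u ih =>
    have hu' : u < T := hu
    rw [List.range_succ, List.flatMap_append, clEval_append, List.flatMap_singleton]
    have h := inv_step hS c₀ hT ⟨u, hu'⟩ _ (ih hu'.le)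
    simpa [stepOpsN, hu'] using h

/-- **Correctness of the reversible tableau of a window machine.** Let `3 d ≤ S` and
`d T ≤ S`. If block `0` of `w` is the one-hot code of `c₀` and all other tableau wires are
blank, then after the tableau program block `T` is exact: its label and state wires are the
one-hot code of `step^[T] c₀`, and so is every cell wire `(k, j, g)` with `j + d T < S`.
(Sipser 2012, proof of Thm. 9.30, and Arora–Barak 2009, proof of Thm. 6.6, in reversible
form: Arora–Barak 2009, Lemma 10.10; this is the deterministic simulation inside
Bernstein–Vazirani 1997, Thm. 8.3.) [cite: Sipser2012, Thm. 9.30 (proof)] -/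
theorem exact_tableau (hT : M.d * T ≤ S) (w : M.TIdx S T → Bool)
    (h0 : ∀ b, w (Sum.inl (0, b)) = M.enc c₀ b)
    (hz : ∀ s : Fin (T + 1), s ≠ 0 → ∀ b, w (Sum.inl (s, b)) = false)
    (hza : ∀ x, w (Sum.inr x) = false) :
    Exact c₀ (clEval (tableauOps (T := T) hS) w) (Fin.last T) :=
  (inv_tableau_prefix hS c₀ hT w (inv_zero c₀ w h0 hz hza) T le_rfl).exact (Fin.last T)
    (by simp)

/-- In particular, the answer cell: after the tableau program, the wire "cell `0` of stack
`k` of block `T` holds `g`" is on iff cell `0` of stack `k` of `step^[T] c₀` is `g`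
(`d T < S`). [cite: Sipser2012, Thm. 9.30 (proof)] -/
theorem tableau_cell_zero (hT : M.d * T < S) (w : M.TIdx S T → Bool)
    (h0 : ∀ b, w (Sum.inl (0, b)) = M.enc c₀ b)
    (hz : ∀ s : Fin (T + 1), s ≠ 0 → ∀ b, w (Sum.inl (s, b)) = false)
    (hza : ∀ x, w (Sum.inr x) = false) (k : Fin M.κ) (g : Fin M.A) :
    clEval (tableauOps (T := T) hS) w (Sum.inl (Fin.last T, M.cellB k ⟨0, by omega⟩ g)) =
      decide ((M.step^[T] c₀).cell k 0 = g) :=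
  (exact_tableau hS c₀ hT.le w h0 hz hza).cell k ⟨0, by omega⟩ g (by simpa using hT)

end Invariant

/-! ### Well-formedness and size -/

section Size

variable {M} {S T : ℕ} (hS : 3 * M.d ≤ S)

/-- Every operation of the tableau program has pairwise distinct wires. [folklore] -/
theorem tableauOps_wf : ∀ op ∈ tableauOps (T := T) hS, op.WF := by
  intro op hop
  simp only [tableauOps, List.mem_flatMap, List.mem_range] at hop
  obtain ⟨t, ht, hop⟩ := hop
  simp only [stepOpsN, ht, dif_pos, stepOps, List.mem_flatMap, List.mem_append] at hop
  obtain ⟨ξ, -, hop | hop⟩ := hop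
  · simp only [chainOps, List.mem_cons] at hop
    rcases hop with rfl | hop
    · trivial
    · refine wf_of_mem_clChain (ancs_nodup _ _) (anc_zero_not_mem_ancs _ _) (fun l hl => ?_) hop
      obtain ⟨b, rfl⟩ := exists_eq_of_mem_lits hS hl
      refine ⟨fun h => ?_, fun h => by cases h⟩
      obtain ⟨q, hq⟩ := (mem_ancs_iff _ _ _).1 h
      cases hq
  · simp only [outOps, List.mem_map] at hop
    obtain ⟨b, hb, rfl⟩ := hop
    rcases b with l | v | ⟨k, j, g⟩
    · exact fun h => by cases h
    · exact fun h => by cases h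
    · simp only [opFor]
      split_ifs
      · exact fun h => by cases h
      · refine ⟨fun h => (by cases h), fun h => (by cases h), fun h => ?_⟩
        simp only [Sum.inl.injEq, Prod.mk.injEq] at h
        exact absurd h.1 (ne_of_lt Fin.castSucc_lt_succ)

end Size

/-! ### Explicit wire numbering -/

section Numbering

/-- The number of wires of one block: `nL + (nV + κ · (S · A))` (reducible, so that the
`Fin` sum and product equivalences below elaborate at this type). [folklore] -/
abbrev bsize (S : ℕ) : ℕ := M.nL + (M.nV + M.κ * (S * M.A))

/-- **Affine numbering of the wires of a block**: label `l ↦ l`, state `v ↦ nL + v`, cell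
`(k, j, g) ↦ nL + nV + g + A · j + S · A · k` (`finSumFinEquiv`, `finProdFinEquiv`).
[folklore] -/
def eB (S : ℕ) : M.BIdx S ≃ Fin (M.bsize S) :=
  (Equiv.sumCongr (Equiv.refl _) ((Equiv.sumCongr (Equiv.refl _)
    ((Equiv.prodCongr (Equiv.refl _) finProdFinEquiv).trans finProdFinEquiv)).trans
      finSumFinEquiv)).trans finSumFinEquiv

/-- The number of tableau wires: `(T + 1)` blocks and `T · nPat · (r + 1)` ancillas
(reducible, see `bsize`). [folklore] -/
abbrev tsize (S T : ℕ) : ℕ := (T + 1) * M.bsize S + T * (M.nPat * (M.r + 1))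

/-- **Affine numbering of the tableau wires**: block wire `(t, b) ↦ eB b + bsize · t`,
ancilla `(t, ξ, q) ↦ (T + 1) · bsize + q + (r + 1) · ePat ξ + nPat · (r + 1) · t`.
[folklore] -/
def eT (S T : ℕ) : M.TIdx S T ≃ Fin (M.tsize S T) :=
  (Equiv.sumCongr
    ((Equiv.prodCongr (Equiv.refl _) (M.eB S)).trans finProdFinEquiv)
    ((Equiv.prodCongr (Equiv.refl _) ((Equiv.prodCongr M.ePat (Equiv.refl _)).trans
      finProdFinEquiv)).trans finProdFinEquiv)).trans finSumFinEquiv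

/-- The number of a label wire. [folklore] -/
theorem eB_inl (S : ℕ) (l : Fin M.nL) : (M.eB S (Sum.inl l) : ℕ) = l := by
  simp [eB]

/-- The number of a state wire. [folklore] -/
theorem eB_inr_inl (S : ℕ) (v : Fin M.nV) : (M.eB S (Sum.inr (Sum.inl v)) : ℕ) = M.nL + v := by
  simp [eB]

/-- The number of a cell wire. [folklore] -/
theorem eB_cellB {S : ℕ} (k : Fin M.κ) (j : Fin S) (g : Fin M.A) :
    (M.eB S (M.cellB k j g) : ℕ) = M.nL + (M.nV + ((g : ℕ) + M.A * (j : ℕ) + S * M.A * (k : ℕ))) := by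
  simp [eB, cellB]

/-- The number of a block wire. [folklore] -/
theorem eT_inl {S T : ℕ} (t : Fin (T + 1)) (b : M.BIdx S) :
    (M.eT S T (Sum.inl (t, b)) : ℕ) = (M.eB S b : ℕ) + M.bsize S * t := by
  simp [eT]

/-- The number of an ancilla wire. [folklore] -/
theorem eT_inr {S T : ℕ} (t : Fin T) (ξ : M.Pat) (q : Fin (M.r + 1)) :
    (M.eT S T (Sum.inr (t, ξ, q)) : ℕ) =
      (T + 1) * M.bsize S + ((q : ℕ) + (M.r + 1) * (M.ePat ξ : ℕ) + M.nPat * (M.r + 1) * (t : ℕ)) := by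
  simp [eT]

end Numbering

end WM

end Literature.Computability.QuantumComplexity
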